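import Summits.Ventures.PercRepro.C026PFunTwoLiveAdjacent
import Summits.Ventures.PercRepro.C026PFunTwoLiveForest

/-!
# CONJECTURE (P) on complete multigraphs with at most two live vertices (p6, gen 18)

A multigraph is **complete** when every two distinct vertices are joined by some edge.  On such a
skeleton any two live vertices are adjacent, so THEOREM L2 on adjacent live vertices
(`C026PFunTwoLiveAdjacent`) applies: `(P) ≥ 0` at every band state of the probe and of two live
vertices `a ≠ b`; when the two live vertices coincide the state is a one-live-vertex band state and
`pFun_oneLive_nonneg` (`C026PFunTwoLiveForest`) applies.  Hence CONJECTURE (P) holds on every complete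
multigraph `K_n` (loops and parallel edges allowed) for every band state with at most two live
vertices — the statement the writer can quote verbatim.
-/

namespace PercRepro

namespace MultiGraph

open Finset

variable {V E : Type*} [Fintype V] [DecidableEq V] [Fintype E] [DecidableEq E]
  {G : MultiGraph V E}

/-- **CONJECTURE (P) on complete multigraphs, two distinct live vertices**: if every two distinct
vertices are joined by an edge, `(P) ≥ 0` at every band state of the probe `c` and of the live
vertices `a ≠ b`. -/
theorem pFun_threeCells_nonneg_of_complete
    (hG : ∀ u v : V, u ≠ v → ∃ f : E, (G.fst f = u ∧ G.snd f = v) ∨ (G.fst f = v ∧ G.snd f = u))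
    {a b c : V} (hab : a ≠ b) {z κ x₁ K₁ x₂ K₂ : ℝ} (hz : 0 ≤ z ∧ z ≤ 1) (hκ : kMin z ≤ κ)
    (hx₁ : 0 ≤ x₁ ∧ x₁ ≤ 1) (hx₂ : 0 ≤ x₂ ∧ x₂ ≤ 1) (hK₁ : kMin x₁ ≤ K₁) (hK₂ : kMin x₂ ≤ K₂) :
    0 ≤ G.pFun c (threeCells c a b z x₁ x₂) (threeCells c a b κ K₁ K₂) univ := by
  obtain ⟨f, hf⟩ := hG a b hab
  exact pFun_threeCells_nonneg_of_edge_ab a b c f hf hz hκ hx₁ hx₂ hK₁ hK₂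

omit [Fintype V] [Fintype E] [DecidableEq E] in
/-- Two live cells at the same vertex multiply: `threeCells c a a z x₁ x₂` is the one-live-vertex
cell assignment with the product cell `x₁ x₂` at `a`. -/
theorem threeCells_self_eq (c a : V) (z x₁ x₂ : ℝ) :
    threeCells c a a z x₁ x₂ =
      fun v => (if v = c then z else 1) * (if v = a then x₁ * x₂ else 1) := by
  funext v
  simp only [threeCells]
  split_ifs <;> ring

/-- **CONJECTURE (P) on complete multigraphs, at most two live vertices**: on a complete multigraph,
`(P) ≥ 0` at every band state of the probe and of two live vertices, whether or not they coincide
(when they coincide, the product cell is a band cell by `kMin_mul_le`). -/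
theorem pFun_threeCells_nonneg_of_complete'
    (hG : ∀ u v : V, u ≠ v → ∃ f : E, (G.fst f = u ∧ G.snd f = v) ∨ (G.fst f = v ∧ G.snd f = u))
    (a b c : V) {z κ x₁ K₁ x₂ K₂ : ℝ} (hz : 0 ≤ z ∧ z ≤ 1) (hκ : kMin z ≤ κ)
    (hx₁ : 0 ≤ x₁ ∧ x₁ ≤ 1) (hx₂ : 0 ≤ x₂ ∧ x₂ ≤ 1) (hK₁ : kMin x₁ ≤ K₁) (hK₂ : kMin x₂ ≤ K₂) :
    0 ≤ G.pFun c (threeCells c a b z x₁ x₂) (threeCells c a b κ K₁ K₂) univ := by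
  by_cases hab : a = b
  · subst hab
    rw [threeCells_self_eq c a z x₁ x₂, threeCells_self_eq c a κ K₁ K₂]
    have hK : kMin (x₁ * x₂) ≤ K₁ * K₂ :=
      (kMin_mul_le hx₁ hx₂).trans
        (mul_le_mul hK₁ hK₂ (kMin_nonneg _) ((kMin_nonneg _).trans hK₁))
    exact pFun_oneLive_nonneg c a hz hκ ⟨mul_nonneg hx₁.1 hx₂.1, mul_le_one₀ hx₁.2 hx₂.1 hx₂.2⟩ hK
  · exact pFun_threeCells_nonneg_of_complete hG hab hz hκ hx₁ hx₂ hK₁ hK₂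

end MultiGraph

end PercRepro
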